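import Literature.Analysis.FluidPDE.HardSphereBoundaryFlux
import HarnessLib

/-!
# The flux formula as an EQUALITY for functions supported in the collision chart
(Cercignani–Illner–Pulvirenti 1994 App. 4.A pp. 108–111; trunk T-KINETIC, topic Analysis/FluidPDE;
step C3a of the plan for the one-step mild BBGKY hierarchy almost everywhere (input (H1) of
`hs_seriesFamily_ae_eq_of_oneStep`, hence of fact (c) `bodineau_gallagher_saintRaymond_linear`).)

`HardSphereBoundaryFlux.lintegral_ge_boundaryFlux` bounds the flux integral over the outgoing
collision coordinates `(W', w, ν, τ)` inside the chart of radius `ρ < 1/2` by the Lebesgue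
integral: `∫ g dZ_{s+1} ≥ ∫ dW' dw dσ(ν) dτ 1_{⟪u,ν⟫>0} ε^{d-1}⟪u,ν⟫ 1_{‖εν+τu‖≤ρ} g(…)`. The
two inequalities in its proof — Haar measure on `T^d` versus Lebesgue measure on the chart ball,
and the chart ball versus the collision cylinder — are equalities for integrands supported in the
chart image of the collision cylinder. This file PROVES the resulting EQUALITY
(`lintegral_eq_boundaryFlux`) for measurable `g ≥ 0` vanishing at every configuration
`appendParticle W' (x'_i + proj r) w` with `r` in the cube `(-1/2, 1/2]^d` but outside
`B̄(0, ρ) ∩ (collision cylinder of u = w - v'_i)` — the change of variables to collision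
coordinates used to compute, not only bound, the contribution of the single-collision events in
the derivation of the BBGKY hierarchy (CIP 1994 App. 4.B).

## References

* C. Cercignani, R. Illner, M. Pulvirenti, *The Mathematical Theory of Dilute Gases*, Springer
  (1994), App. 4.A pp. 108–111 (special flow representation), App. 4.B.
-/

open MeasureTheory MeasureTheory.Measure Metric Real Set Filter Function Module
open scoped ENNReal InnerProductSpace Topology Pointwise

namespace Literature.Analysis.FluidPDE

noncomputable section

section Kinetic

variable {d : Type*} [Fintype d]

/-- The open collision cylinder is measurable (Lusin–Souslin: injective continuous image of an
open set). [folklore] -/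
theorem measurableSet_collisionCylRegion {ε : ℝ} (hε : 0 < ε) (u : EuclideanSpace ℝ d) :
    MeasurableSet (collisionCylRegion ε u) := by
  refine (measurableSet_collisionCylDom u).image_of_continuousOn_injOn ?_ (injOn_collisionCylMap hε u)
  intro y hy
  have hy0 : y ≠ 0 := ne_zero_of_mem_collisionCylDom hy
  refine ContinuousAt.continuousWithinAt ?_
  unfold collisionCylMap
  have h1 : ContinuousAt (fun y : EuclideanSpace ℝ d => (ε / ‖y‖) • y) y :=
    ((continuousAt_const.div continuousAt_id.norm (norm_ne_zero_iff.2 hy0)).smul continuousAt_id)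
  have h2 : ContinuousAt (fun y : EuclideanSpace ℝ d => ‖y‖ • u) y := continuousAt_id.norm.smul continuousAt_const
  exact h1.add h2

/-- **Haar measure on `T^d` versus the chart, as an equality**: for measurable `H ≥ 0` vanishing
at `a + proj r` for every `r` in the cube outside a measurable `S ⊆ B̄(0, ρ)`, `ρ < 1/2`,
`∫ H dx = ∫_S H(a + proj r) dr`. [folklore] -/
theorem lintegral_torus_eq_chart (H : UnitAddTorus d → ℝ≥0∞) (hH : Measurable H) (a : UnitAddTorus d)
    {ρ : ℝ} (hρ : ρ < 1 / 2) {S : Set (EuclideanSpace ℝ d)} (hSm : MeasurableSet S)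
    (hS : S ⊆ closedBall (0 : EuclideanSpace ℝ d) ρ)
    (h0 : ∀ r ∈ Torus.symCube d, r ∉ S → H (a + FunctionSpaces.Torus.proj r) = 0) :
    ∫⁻ x, H x = ∫⁻ r in S, H (a + FunctionSpaces.Torus.proj r) := by
  have h1 : ∫⁻ x, H x = ∫⁻ x, H (x + a) := (lintegral_add_right_eq_self H a).symm
  have h2 : ∫⁻ x, H (x + a) = ∫⁻ r in Torus.symCube d, H (FunctionSpaces.Torus.proj r + a) := by
    have hm : Measurable fun x : UnitAddTorus d => H (x + a) := hH.comp (measurable_add_const a)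
    rw [← Torus.map_proj_volume_restrict_symCube, lintegral_map hm FunctionSpaces.Torus.measurable_proj]
  rw [h1, h2]
  have hSc : S ⊆ Torus.symCube d := hS.trans (Torus.closedBall_subset_symCube hρ)
  have h3 : ∫⁻ r in Torus.symCube d, H (FunctionSpaces.Torus.proj r + a) =
      ∫⁻ r in Torus.symCube d, S.indicator (fun r => H (a + FunctionSpaces.Torus.proj r)) r := by
    refine setLIntegral_congr_fun Torus.measurableSet_symCube (fun r hr => ?_)
    by_cases hrS : r ∈ S
    · rw [indicator_of_mem hrS, add_comm]
    · rw [indicator_of_notMem hrS, add_comm, h0 r hr hrS]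
  rw [h3, lintegral_indicator hSm, Measure.restrict_restrict hSm, inter_eq_left.2 hSc]

/-- **The chart ball versus the collision cylinder, as an equality**: for measurable `K ≥ 0`,
`ε > 0`, `u ∈ ℝ^d` and any `ρ`,
`∫_{B̄(0,ρ) ∩ Cyl(u)} K = ∫ dσ(ν) ∫_{τ>0} 1_{⟪u,ν⟫>0} ε^{d-1} ⟪u, ν⟫ 1_{‖εν+τu‖≤ρ} K(εν + τu)`
(`lintegral_collisionCylinder` applied to `1_{B̄(0,ρ)} K`). [cite: CIP1994, App. 4.A p. 108] -/
theorem lintegral_chart_inter_cylinder_eq [Nonempty d] (K : EuclideanSpace ℝ d → ℝ≥0∞) (hK : Measurable K)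
    {ε : ℝ} (hε : 0 < ε) (u : EuclideanSpace ℝ d) (ρ : ℝ) :
    ∫⁻ r in closedBall (0 : EuclideanSpace ℝ d) ρ ∩ collisionCylRegion ε u, K r =
      ∫⁻ ν : sphere (0 : EuclideanSpace ℝ d) 1, ∫⁻ τ in Ioi (0 : ℝ),
        (collisionCylDom u).indicator (fun _ => (1 : ℝ≥0∞)) (ν : EuclideanSpace ℝ d) *
          (ENNReal.ofReal (ε ^ (Fintype.card d - 1) * ⟪u, (ν : EuclideanSpace ℝ d)⟫_ℝ) *
            ((closedBall (0 : EuclideanSpace ℝ d) ρ).indicator K (ε • (ν : EuclideanSpace ℝ d) + τ • u)))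
          ∂volume ∂(volume : Measure (EuclideanSpace ℝ d)).toSphere := by
  have hfin : finrank ℝ (EuclideanSpace ℝ d) = Fintype.card d := finrank_euclideanSpace
  have key := lintegral_collisionCylinder (volume : Measure (EuclideanSpace ℝ d)) hε u
    ((closedBall (0 : EuclideanSpace ℝ d) ρ).indicator K) (hK.indicator measurableSet_closedBall)
  rw [hfin] at key
  rw [← key, lintegral_indicator measurableSet_closedBall, Measure.restrict_restrict measurableSet_closedBall]

/-- **The flux formula as an equality.** For `s` spheres on `T^d`, a label `i`, `ε > 0`, a chart
radius `ρ < 1/2` and measurable `g ≥ 0` on `Config (s + 1)` VANISHING at every configuration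
`appendParticle W' (x'_i + proj r) w` with `r ∈ (-1/2, 1/2]^d` outside
`B̄(0, ρ) ∩ Cyl_ε(w - v'_i)`:
`∫ g dZ_{s+1} = ∫ dW' ∫ dw ∫ dσ(ν) ∫_{τ>0} 1_{⟪u,ν⟫>0} ε^{d-1} ⟪u, ν⟫ 1_{‖εν+τu‖≤ρ}
g (appendParticle W' (x'_i + proj (εν + τu)) w)`, `u = w - v'_i` — the equality case of
`lintegral_ge_boundaryFlux`. [cite: CIP1994, App. 4.A pp. 108–111] -/
theorem lintegral_eq_boundaryFlux [Nonempty d] {s : ℕ} (i : Fin s) {ε : ℝ} (hε : 0 < ε) {ρ : ℝ} (hρ : ρ < 1 / 2)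
    (g : Config (s + 1) d (UnitAddTorus d) → ℝ≥0∞) (hg : Measurable g)
    (hg0 : ∀ (W' : Config s d (UnitAddTorus d)) (w : EuclideanSpace ℝ d) (r : EuclideanSpace ℝ d),
      r ∈ Torus.symCube d → r ∉ closedBall (0 : EuclideanSpace ℝ d) ρ ∩ collisionCylRegion ε (w - (W' i).2) →
        g (appendParticle W' ((W' i).1 + FunctionSpaces.Torus.proj r) w) = 0) :
    ∫⁻ W' : Config s d (UnitAddTorus d), ∫⁻ w : EuclideanSpace ℝ d,
        ∫⁻ ν : sphere (0 : EuclideanSpace ℝ d) 1, ∫⁻ τ in Ioi (0 : ℝ),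
          (collisionCylDom (w - (W' i).2)).indicator (fun _ => (1 : ℝ≥0∞)) (ν : EuclideanSpace ℝ d) *
            (ENNReal.ofReal (ε ^ (Fintype.card d - 1) * ⟪w - (W' i).2, (ν : EuclideanSpace ℝ d)⟫_ℝ) *
              ((closedBall (0 : EuclideanSpace ℝ d) ρ).indicator
                (fun r => g (appendParticle W' ((W' i).1 + FunctionSpaces.Torus.proj r) w))
                (ε • (ν : EuclideanSpace ℝ d) + τ • (w - (W' i).2))))
          ∂volume ∂(volume : Measure (EuclideanSpace ℝ d)).toSphere =
      ∫⁻ W, g W := by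
  rw [lintegral_config_succ g hg]
  refine lintegral_congr fun W' => ?_
  have hgz : Measurable fun z : UnitAddTorus d × EuclideanSpace ℝ d => g (appendParticle W' z.1 z.2) :=
    hg.comp (measurable_appendParticle measurable_const measurable_fst measurable_snd)
  rw [Measure.volume_eq_prod, lintegral_prod _ hgz.aemeasurable]
  conv_rhs => rw [lintegral_lintegral_swap hgz.aemeasurable]
  refine lintegral_congr fun w => ?_
  have hK : Measurable fun r : EuclideanSpace ℝ d =>
      g (appendParticle W' ((W' i).1 + FunctionSpaces.Torus.proj r) w) :=
    hg.comp (measurable_appendParticle measurable_const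
      (measurable_const.add FunctionSpaces.Torus.measurable_proj) measurable_const)
  have hH : Measurable fun x : UnitAddTorus d => g (appendParticle W' x w) :=
    hg.comp (measurable_appendParticle measurable_const measurable_id measurable_const)
  have hSm : MeasurableSet (closedBall (0 : EuclideanSpace ℝ d) ρ ∩ collisionCylRegion ε (w - (W' i).2)) :=
    measurableSet_closedBall.inter (measurableSet_collisionCylRegion hε _)
  rw [lintegral_torus_eq_chart _ hH (W' i).1 hρ hSm inter_subset_left (fun r hr hrS => hg0 W' w r hr hrS),
    lintegral_chart_inter_cylinder_eq _ hK hε (w - (W' i).2) ρ]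

/-- **The flux formula as an equality, in contact-time coordinates.** Under the hypotheses of
`lintegral_eq_boundaryFlux`,
`∫ g dZ_{s+1} = ∫ dZ' ∫ dw ∫ dσ(ν) ∫_{τ>0} 1_{⟪u,ν⟫>0} ε^{d-1} ⟪u, ν⟫ 1_{‖εν+τu‖≤ρ} g (S_τ (lossConfig Z' i ν w))`,
`u = w - v_i`: the configurations are read from the configuration `Z'` of the old spheres at the
contact time (`freeFlight_lossConfig_torus` and the volume-preserving shear
`measurePreserving_freeFlight_shear`). [cite: CIP1994, App. 4.A pp. 108–111] -/
theorem lintegral_eq_boundaryFlux_contact [Nonempty d] {s : ℕ} (i : Fin s) {ε : ℝ} (hε : 0 < ε) {ρ : ℝ} (hρ : ρ < 1 / 2)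
    (g : Config (s + 1) d (UnitAddTorus d) → ℝ≥0∞) (hg : Measurable g)
    (hg0 : ∀ (W' : Config s d (UnitAddTorus d)) (w : EuclideanSpace ℝ d) (r : EuclideanSpace ℝ d),
      r ∈ Torus.symCube d → r ∉ closedBall (0 : EuclideanSpace ℝ d) ρ ∩ collisionCylRegion ε (w - (W' i).2) →
        g (appendParticle W' ((W' i).1 + FunctionSpaces.Torus.proj r) w) = 0) :
    ∫⁻ Z' : Config s d (UnitAddTorus d), ∫⁻ w : EuclideanSpace ℝ d,
        ∫⁻ ν : sphere (0 : EuclideanSpace ℝ d) 1, ∫⁻ τ in Ioi (0 : ℝ),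
          (collisionCylDom (w - (Z' i).2)).indicator (fun _ => (1 : ℝ≥0∞)) (ν : EuclideanSpace ℝ d) *
            (ENNReal.ofReal (ε ^ (Fintype.card d - 1) * ⟪w - (Z' i).2, (ν : EuclideanSpace ℝ d)⟫_ℝ) *
              ((closedBall (0 : EuclideanSpace ℝ d) ρ).indicator
                (fun _ => g (freeFlight (Torus.geometry d) τ (lossConfig (Torus.geometry d) ε Z' i ν w)))
                (ε • (ν : EuclideanSpace ℝ d) + τ • (w - (Z' i).2))))
          ∂volume ∂(volume : Measure (EuclideanSpace ℝ d)).toSphere =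
      ∫⁻ W, g W := by
  classical
  haveI hXE : SigmaFinite (volume : Measure (UnitAddTorus d × EuclideanSpace ℝ d)) := inferInstance
  haveI hC : SigmaFinite (volume : Measure (Config s d (UnitAddTorus d))) := inferInstance
  haveI hσf : IsFiniteMeasure ((volume : Measure (EuclideanSpace ℝ d)).toSphere) := inferInstance
  -- the parameter measure (`τ` restricted to `(0, ∞)`)
  set κ : Measure (EuclideanSpace ℝ d × (sphere (0 : EuclideanSpace ℝ d) 1 × ℝ)) :=
    (volume : Measure (EuclideanSpace ℝ d)).prod (((volume : Measure (EuclideanSpace ℝ d)).toSphere).prod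
      ((volume : Measure ℝ).restrict (Ioi 0))) with hκ
  haveI hσp : SFinite (((volume : Measure (EuclideanSpace ℝ d)).toSphere).prod ((volume : Measure ℝ).restrict (Ioi 0))) :=
    inferInstance
  haveI hκs : SFinite κ := by rw [hκ]; infer_instance
  -- the end-time integrand on the product space
  set Fn : Config s d (UnitAddTorus d) × (EuclideanSpace ℝ d × (sphere (0 : EuclideanSpace ℝ d) 1 × ℝ)) → ℝ≥0∞ :=
    fun p => (collisionCylDom (p.2.1 - (p.1 i).2)).indicator (fun _ => (1 : ℝ≥0∞)) (p.2.2.1 : EuclideanSpace ℝ d) *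
      (ENNReal.ofReal (ε ^ (Fintype.card d - 1) * ⟪p.2.1 - (p.1 i).2, (p.2.2.1 : EuclideanSpace ℝ d)⟫_ℝ) *
        ((closedBall (0 : EuclideanSpace ℝ d) ρ).indicator
          (fun r => g (appendParticle p.1 ((p.1 i).1 + FunctionSpaces.Torus.proj r) p.2.1))
          (ε • (p.2.2.1 : EuclideanSpace ℝ d) + p.2.2.2 • (p.2.1 - (p.1 i).2)))) with hFn
  -- measurability
  have hu : Measurable fun p : Config s d (UnitAddTorus d) × (EuclideanSpace ℝ d × (sphere (0 : EuclideanSpace ℝ d) 1 × ℝ)) =>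
      p.2.1 - (p.1 i).2 := measurable_snd.fst.sub ((measurable_pi_apply i).comp measurable_fst).snd
  have hν : Measurable fun p : Config s d (UnitAddTorus d) × (EuclideanSpace ℝ d × (sphere (0 : EuclideanSpace ℝ d) 1 × ℝ)) =>
      (p.2.2.1 : EuclideanSpace ℝ d) := measurable_subtype_coe.comp measurable_snd.snd.fst
  have hτ : Measurable fun p : Config s d (UnitAddTorus d) × (EuclideanSpace ℝ d × (sphere (0 : EuclideanSpace ℝ d) 1 × ℝ)) =>
      p.2.2.2 := measurable_snd.snd.snd
  have hr : Measurable fun p : Config s d (UnitAddTorus d) × (EuclideanSpace ℝ d × (sphere (0 : EuclideanSpace ℝ d) 1 × ℝ)) =>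
      ε • (p.2.2.1 : EuclideanSpace ℝ d) + p.2.2.2 • (p.2.1 - (p.1 i).2) := (hν.const_smul ε).add (hτ.smul hu)
  have hdom : Measurable fun p : Config s d (UnitAddTorus d) × (EuclideanSpace ℝ d × (sphere (0 : EuclideanSpace ℝ d) 1 × ℝ)) =>
      (collisionCylDom (p.2.1 - (p.1 i).2)).indicator (fun _ => (1 : ℝ≥0∞)) (p.2.2.1 : EuclideanSpace ℝ d) := by
    have hset : MeasurableSet {p : Config s d (UnitAddTorus d) × (EuclideanSpace ℝ d × (sphere (0 : EuclideanSpace ℝ d) 1 × ℝ)) |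
        0 < ⟪p.2.1 - (p.1 i).2, (p.2.2.1 : EuclideanSpace ℝ d)⟫_ℝ} :=
      measurableSet_lt measurable_const (hu.inner hν)
    have : (fun p : Config s d (UnitAddTorus d) × (EuclideanSpace ℝ d × (sphere (0 : EuclideanSpace ℝ d) 1 × ℝ)) =>
        (collisionCylDom (p.2.1 - (p.1 i).2)).indicator (fun _ => (1 : ℝ≥0∞)) (p.2.2.1 : EuclideanSpace ℝ d)) =
        {p | 0 < ⟪p.2.1 - (p.1 i).2, (p.2.2.1 : EuclideanSpace ℝ d)⟫_ℝ}.indicator (fun _ => (1 : ℝ≥0∞)) := by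
      funext p
      by_cases h : 0 < ⟪p.2.1 - (p.1 i).2, (p.2.2.1 : EuclideanSpace ℝ d)⟫_ℝ
      · rw [indicator_of_mem (show (p.2.2.1 : EuclideanSpace ℝ d) ∈ collisionCylDom (p.2.1 - (p.1 i).2) from h),
          indicator_of_mem (show p ∈ {p : Config s d (UnitAddTorus d) × (EuclideanSpace ℝ d × (sphere (0 : EuclideanSpace ℝ d) 1 × ℝ)) |
            0 < ⟪p.2.1 - (p.1 i).2, (p.2.2.1 : EuclideanSpace ℝ d)⟫_ℝ} from h)]
      · rw [indicator_of_notMem (show (p.2.2.1 : EuclideanSpace ℝ d) ∉ collisionCylDom (p.2.1 - (p.1 i).2) from h),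
          indicator_of_notMem (show p ∉ {p : Config s d (UnitAddTorus d) × (EuclideanSpace ℝ d × (sphere (0 : EuclideanSpace ℝ d) 1 × ℝ)) |
            0 < ⟪p.2.1 - (p.1 i).2, (p.2.2.1 : EuclideanSpace ℝ d)⟫_ℝ} from h)]
    rw [this]
    exact measurable_const.indicator hset
  have hflux : Measurable fun p : Config s d (UnitAddTorus d) × (EuclideanSpace ℝ d × (sphere (0 : EuclideanSpace ℝ d) 1 × ℝ)) =>
      ENNReal.ofReal (ε ^ (Fintype.card d - 1) * ⟪p.2.1 - (p.1 i).2, (p.2.2.1 : EuclideanSpace ℝ d)⟫_ℝ) :=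
    (measurable_const.mul (hu.inner hν)).ennreal_ofReal
  have happ : Measurable fun q : (Config s d (UnitAddTorus d) × (EuclideanSpace ℝ d × (sphere (0 : EuclideanSpace ℝ d) 1 × ℝ))) × EuclideanSpace ℝ d =>
      g (appendParticle q.1.1 ((q.1.1 i).1 + FunctionSpaces.Torus.proj q.2) q.1.2.1) :=
    hg.comp (measurable_appendParticle measurable_fst.fst
      (((measurable_pi_apply i).comp measurable_fst.fst).fst.add (FunctionSpaces.Torus.measurable_proj.comp measurable_snd))
      measurable_fst.snd.fst)
  have hball : Measurable fun p : Config s d (UnitAddTorus d) × (EuclideanSpace ℝ d × (sphere (0 : EuclideanSpace ℝ d) 1 × ℝ)) =>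
      (closedBall (0 : EuclideanSpace ℝ d) ρ).indicator
        (fun r => g (appendParticle p.1 ((p.1 i).1 + FunctionSpaces.Torus.proj r) p.2.1))
        (ε • (p.2.2.1 : EuclideanSpace ℝ d) + p.2.2.2 • (p.2.1 - (p.1 i).2)) := by
    have h2 : Measurable fun p : Config s d (UnitAddTorus d) × (EuclideanSpace ℝ d × (sphere (0 : EuclideanSpace ℝ d) 1 × ℝ)) =>
        g (appendParticle p.1 ((p.1 i).1 + FunctionSpaces.Torus.proj (ε • (p.2.2.1 : EuclideanSpace ℝ d) + p.2.2.2 • (p.2.1 - (p.1 i).2))) p.2.1) :=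
      happ.comp (measurable_id.prodMk hr)
    have heq : (fun p : Config s d (UnitAddTorus d) × (EuclideanSpace ℝ d × (sphere (0 : EuclideanSpace ℝ d) 1 × ℝ)) =>
        (closedBall (0 : EuclideanSpace ℝ d) ρ).indicator
          (fun r => g (appendParticle p.1 ((p.1 i).1 + FunctionSpaces.Torus.proj r) p.2.1))
          (ε • (p.2.2.1 : EuclideanSpace ℝ d) + p.2.2.2 • (p.2.1 - (p.1 i).2))) =
        fun p => if ε • (p.2.2.1 : EuclideanSpace ℝ d) + p.2.2.2 • (p.2.1 - (p.1 i).2) ∈ closedBall (0 : EuclideanSpace ℝ d) ρ then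
          g (appendParticle p.1 ((p.1 i).1 + FunctionSpaces.Torus.proj (ε • (p.2.2.1 : EuclideanSpace ℝ d) + p.2.2.2 • (p.2.1 - (p.1 i).2))) p.2.1)
          else 0 := by
      funext p
      by_cases h : ε • (p.2.2.1 : EuclideanSpace ℝ d) + p.2.2.2 • (p.2.1 - (p.1 i).2) ∈ closedBall (0 : EuclideanSpace ℝ d) ρ
      · rw [indicator_of_mem h, if_pos h]
      · rw [indicator_of_notMem h, if_neg h]
    rw [heq]
    exact Measurable.ite (measurableSet_closedBall.preimage hr) h2 measurable_const
  have hFm : Measurable Fn := by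
    rw [hFn]
    exact hdom.mul (hflux.mul hball)
  -- the shear
  have hΘ := measurePreserving_freeFlight_shear (d := d) (s := s) κ
    (t := fun q : EuclideanSpace ℝ d × (sphere (0 : EuclideanSpace ℝ d) 1 × ℝ) => q.2.2) measurable_snd.snd
  -- iterated integrals as integrals over the product
  have hiter : ∀ (F : Config s d (UnitAddTorus d) × (EuclideanSpace ℝ d × (sphere (0 : EuclideanSpace ℝ d) 1 × ℝ)) → ℝ≥0∞),
      Measurable F →
      ∫⁻ Z' : Config s d (UnitAddTorus d), ∫⁻ w : EuclideanSpace ℝ d, ∫⁻ ν : sphere (0 : EuclideanSpace ℝ d) 1, ∫⁻ τ in Ioi (0 : ℝ),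
          F (Z', (w, (ν, τ))) ∂volume ∂(volume : Measure (EuclideanSpace ℝ d)).toSphere =
        ∫⁻ p, F p ∂((volume : Measure (Config s d (UnitAddTorus d))).prod κ) := by
    intro F hF
    rw [lintegral_prod _ hF.aemeasurable]
    refine lintegral_congr fun Z' => ?_
    have hF1 : Measurable fun q : EuclideanSpace ℝ d × (sphere (0 : EuclideanSpace ℝ d) 1 × ℝ) => F (Z', q) :=
      hF.comp (measurable_const.prodMk measurable_id)
    rw [hκ, lintegral_prod _ hF1.aemeasurable]
    refine lintegral_congr fun w => ?_
    have hF2 : Measurable fun q : sphere (0 : EuclideanSpace ℝ d) 1 × ℝ => F (Z', (w, q)) :=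
      hF1.comp (measurable_const.prodMk measurable_id)
    rw [lintegral_prod _ hF2.aemeasurable]
  -- the end-time form
  have hend := lintegral_eq_boundaryFlux i hε hρ g hg hg0
  rw [← hend, hiter Fn hFm, ← hΘ.lintegral_comp hFm,
    ← hiter (fun p => Fn (freeFlight (Torus.geometry d) p.2.2.2 p.1, p.2)) (hFm.comp hΘ.measurable)]
  refine lintegral_congr fun Z' => lintegral_congr fun w => lintegral_congr fun ν => ?_
  refine setLIntegral_congr_fun measurableSet_Ioi (fun τ _ => ?_)
  simp only [hFn, freeFlight_apply]
  congr 1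
  by_cases h : ε • (ν : EuclideanSpace ℝ d) + τ • (w - (Z' i).2) ∈ closedBall (0 : EuclideanSpace ℝ d) ρ
  · rw [indicator_of_mem h, indicator_of_mem h, freeFlight_lossConfig_torus]
    rfl
  · rw [indicator_of_notMem h, indicator_of_notMem h]

end Kinetic

end

end Literature.Analysis.FluidPDE
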